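import Literature.NumberTheory.LFunctions.DobnerSelbergClassNewmanProofs
import Literature.NumberTheory.LFunctions.DobnerSelbergClassSeriesProofs
import Literature.NumberTheory.LFunctions.DobnerLemma2Proofs
import Literature.NumberTheory.LFunctions.DobnerSelbergClassTheorem1Proofs
import HarnessLib

/-!
# The kernel `Φ_F` of `F ∈ 𝒮♯` is de Bruijn-admissible (Dobner 2021, proof of Thm. 1, pp. 6–7)

RH-FREE literature proofs (no definitions, no named facts, no `sorry`). Trunk T-ANT
(`Literature/NumberTheory/LFunctions`); nodes T1-a/T1-b of the C3 cell's T1 programme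
(`Literature.NumberTheory.LFunctions.dobner_theorem1` from `dobner_theorem2`; rt/STATUS 2026-08-26).

> A. Dobner, *A proof of Newman's conjecture for the extended Selberg class*, Acta Arith. 201
> (2021), 29–62 = arXiv:2005.05142 (held; pages of the 18-page arXiv text), **proof of Thm. 1**,
> pp. 6–7: "The functional equation implies that `H(x) = conj H(x)` for any real `x` … its Fourier
> transform `Φ_F` has the conjugate symmetry property `Φ_F(u) = conj Φ_F(−u)` … To bound `Φ_F` we
> … rewrite (Φ_F) as a complex contour integral `Φ_F(u) = (e^u/πi) ∫_{½−i∞}^{½+i∞} ξ^F(w) e^{−2uw} dw`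
> … shift the vertical line contour to the right into the half-plane of absolute convergence …
> `Φ_F(u) = 2α e^u ∑ aₙ ψ(n e^{2u}/Q)`, `ψ` the inverse Mellin transform of
> `Ψ(w) = w^m (w−1)^m ∏ Γ(ωⱼ w + μⱼ)` … by [the relation `wΓ(aw+b) = a⁻¹Γ(aw+b+1) − (b/a)Γ(aw+b)`]
> one can write `ψ` as a linear combination of functions to which [Lemma 2] does apply … Hence
> `Φ_F(u) ≪ e^u e^{−e^{2δu}/(2Q^δ)} ≪ e^{−e^{2δu}/(3Q^δ)}` … Hence `Φ_F` has rapid enough decay that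
> Theorem 3 [de Bruijn] applies."

## Main results (all `theorem`s, 0 new facts; `D : ExtendedSelbergDatum`, `k ≥ 1` where marked)

* `ExtendedSelbergDatum.Phi_neg` : `Φ_F(−u) = conj Φ_F(u)`;
* `ExtendedSelbergDatum.Phi_eq_integral_two` (`k ≥ 1`): the contour form of `Φ_F` on `Re w = 2`;
* `ExtendedSelbergDatum.Phi_eq_tsum_mellinInv` (`k ≥ 1`): `Φ_F(u) = 2α e^u ∑ₙ aₙ ψ(n e^{2u}/Q)`;
* `ExtendedSelbergDatum.exists_norm_Phi_le_exp_neg_exp` (`k ≥ 1`): double-exponential decay;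
* `ExtendedSelbergDatum.integrable_Phi`, `integrable_kernel_exp_moment_all`,
  `differentiable_Ht_all` (`H_t` entire for EVERY real `t`), `isAdmissible_Phi`,
  `isAdmissible_kernel` (`u ↦ e^{tu²}Φ_F(u)` is a `DeBruijn1950.IsAdmissible` kernel for every real
  `t`), `Ht_add` (the `λ² = 2t` bookkeeping for `DeBruijn1950.thm13`).

Inputs (all theorems of the tree): `dobner_lemma2_holds` (Lemma 2) and the vertical-line tools of
`DobnerLemma2Proofs.lean` (`DobnerLemma2.Psi`, `mellinInv_eq`, `integrable_integrand_vertical`);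
`dobner_lemma1_holds` (Lemma 1); `ExtendedSelbergDatum.exists_entire_xi`,
`exists_norm_xi_le_exp_neg`, `continuous_gamma_two`, `exists_norm_gamma_two_le`,
`continuous_Phi`, `norm_Phi_le`; Cauchy's theorem in the form
`MertensBoundRH.integral_vertical_eq_of_tendsto`; the tilt lemmas
`ExtendedSelbergDatum.isAdmissible_kernel_of_isAdmissible` / `differentiable_Ht_of_isAdmissible`
of `DobnerSelbergClassTheorem1Proofs.lean` (rt-iso), through which (5) and (7) below are one-line
corollaries of (6) (overlap rule R2b, rt-lead ruling (32): one content, one public proof).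
Export names (1)–(8) frozen on rt/STATUS 2026-08-26T09:12:59Z; (6) `isAdmissible_Phi` is the
`hadm` input of `Literature.NumberTheory.LFunctions.dobner_theorem1_of`.

bears_on: N-C/N-P (COLUMN 3 DBN). WHAT THIS IS NOT: Fourier/Mellin bookkeeping for the RH-free
theorem "`Λ_F` exists for every `F ∈ 𝒮♯`"; nothing in this file bears on the truth of RH (or of
GRH for `𝒮♯`).

## References

* A. Dobner, op. cit., §2 (pp. 5–7: `Φ_F`, Lemma 1, Lemma 2, proof of Thm. 1), §5 (pp. 15–16).
* N. G. de Bruijn, Duke Math. J. 17 (1950), Thm. 13 (the admissibility hypotheses).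
-/

noncomputable section

open Complex Filter Set Topology Metric MeasureTheory
open scoped ComplexConjugate

namespace Literature.NumberTheory.LFunctions

namespace ExtendedSelbergDatum

variable (D : ExtendedSelbergDatum)

/-! ### (T1-a) Conjugate symmetry of `Φ_F` -/

/-- The point `(1+ix)/2` of the critical line in `re + im·I` form. [cite: Dobner2021, §2 p. 5] -/
private theorem critical_pt_eq' (x : ℝ) :
    (1 + I * x) / 2 = ((1 / 2 : ℝ) : ℂ) + ((x / 2 : ℝ) : ℂ) * I := by
  push_cast; ring

/-- **`ξ^F` is real on the critical line**: `conj ξ^F((1+ix)/2) = ξ^F((1+ix)/2)` ("the functional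
equation implies that `H(x) = conj H(x)` for any real number `x`", p. 6). [cite: Dobner2021, §2 p. 6 (proof of Thm. 1)] -/
theorem conj_xi_critical_line (x : ℝ) :
    conj (D.xi ((1 + I * x) / 2)) = D.xi ((1 + I * x) / 2) := by
  have hre : ((1 + I * x) / 2 : ℂ).re = 1 / 2 := by rw [critical_pt_eq']; simp
  have h := D.xi_eq_conj_xi ((1 + I * x) / 2) (by rw [hre]; norm_num) (by rw [hre]; norm_num)
  have hs : 1 - conj ((1 + I * x) / 2 : ℂ) = (1 + I * x) / 2 := by
    rw [critical_pt_eq', map_add, map_mul, Complex.conj_ofReal, Complex.conj_ofReal, Complex.conj_I]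
    push_cast
    ring
  rw [hs] at h
  exact h.symm

/-- **Conjugate symmetry of `Φ_F`**: `Φ_F(−u) = conj Φ_F(u)` ("since `H(x)` is real valued for all
`x ∈ ℝ`, its Fourier transform `Φ_F` has the conjugate symmetry property", p. 6). [cite: Dobner2021, §2 p. 6 (proof of Thm. 1)] -/
theorem Phi_neg (u : ℝ) : D.Phi (-u) = conj (D.Phi u) := by
  rw [Phi, Phi, map_mul, ← integral_conj]
  congr 1
  · rw [show (1 / (2 * Real.pi) : ℂ) = ((1 / (2 * Real.pi) : ℝ) : ℂ) by push_cast; ring,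
      Complex.conj_ofReal]
  · refine integral_congr_ae (Eventually.of_forall fun x ↦ ?_)
    dsimp only
    rw [map_mul, D.conj_xi_critical_line x, ← Complex.exp_conj]
    congr 2
    apply Complex.ext <;> simp

/-! ### Integrability of `γ` and `ξ^F` on the line `Re w = 2` -/

/-- `∫ e^{−b|x|} dx < ∞` for `b > 0`. [cite: Dobner2021, §2 p. 6 (proof of Thm. 1: integrability on vertical lines)] -/
private theorem integrable_exp_neg_mul_abs' {b : ℝ} (hb : 0 < b) :
    Integrable fun ξ : ℝ ↦ Real.exp (-b * |ξ|) := by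
  have h1 : IntegrableOn (fun ξ : ℝ ↦ Real.exp (-b * |ξ|)) (Set.Ioi 0) := by
    refine (integrableOn_exp_mul_Ioi (by linarith : -b < 0) 0).congr_fun (fun ξ hξ ↦ ?_)
      measurableSet_Ioi
    rw [abs_of_pos hξ]
  have h2 : IntegrableOn (fun ξ : ℝ ↦ Real.exp (-b * |ξ|)) (Set.Iic 0) := by
    refine (integrableOn_exp_mul_Iic hb 0).congr_fun (fun ξ hξ ↦ ?_) measurableSet_Iic
    rw [abs_of_nonpos hξ]; ring_nf
  have := h2.union h1
  rwa [Set.Iic_union_Ioi, integrableOn_univ] at this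

/-- **`γ` is integrable along `Re w = 2`** (`k ≥ 1`): exponential decay for `|Im w| ≥ T₀`
(Lemma 1, `Literature.NumberTheory.LFunctions.dobner_lemma1_holds`) and boundedness
(`exists_norm_gamma_two_le`). [cite: Dobner2021, Lemma 1, p. 5] -/
theorem integrable_gamma_two (hk : 0 < D.numGamma) :
    Integrable fun y : ℝ ↦ D.gamma (2 + y * I) := by
  obtain ⟨K, K', T₀, hK, -, hγ⟩ := dobner_lemma1_holds D.alpha D.polarOrder D.Q D.numGamma D.omega
    D.mu D.alpha_ne_zero D.Q_pos hk D.omega_pos D.mu_re_nonneg 2 0 two_pos le_rfl one_pos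
  obtain ⟨M, hM, hMb⟩ := D.exists_norm_gamma_two_le hk
  set T₁ : ℝ := max T₀ 0 with hT₁
  set B : ℝ := M * Real.exp (K * T₁) + 1 with hB
  refine (((integrable_exp_neg_mul_abs' hK).const_mul B).mono' D.continuous_gamma_two.aestronglyMeasurable
    (Eventually.of_forall fun y ↦ ?_))
  have hB1 : 1 ≤ B := by
    have : 0 ≤ M * Real.exp (K * T₁) := by positivity
    linarith
  rcases le_or_gt T₁ |y| with h | h
  · have h1 := (hγ (2 + y * I) (by simp) (by simp; exact (le_max_left _ _).trans h)).2
    have e : D.gamma (2 + y * I) = dobnerGamma D.alpha D.polarOrder D.Q D.omega D.mu (2 + y * I) := rfl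
    rw [e]
    calc ‖dobnerGamma D.alpha D.polarOrder D.Q D.omega D.mu (2 + y * I)‖
        ≤ Real.exp (-(K * |(2 + y * I : ℂ).im|)) := h1
      _ = 1 * Real.exp (-K * |y|) := by simp
      _ ≤ B * Real.exp (-K * |y|) := by gcongr
  · have h1 := hMb y
    have h2 : M ≤ B * Real.exp (-K * |y|) := by
      have h3 : 1 ≤ Real.exp (K * T₁) * Real.exp (-K * |y|) := by
        rw [← Real.exp_add]
        exact Real.one_le_exp (by nlinarith [abs_nonneg y])
      calc M ≤ M * (Real.exp (K * T₁) * Real.exp (-K * |y|)) := le_mul_of_one_le_right hM.le h3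
        _ = M * Real.exp (K * T₁) * Real.exp (-K * |y|) := by ring
        _ ≤ B * Real.exp (-K * |y|) := by gcongr; rw [hB]; linarith
    exact h1.trans h2

/-! ### (T1-b, step 1) The contour form of `Φ_F` and the shift to `Re w = 2` -/

/-- The modulus of `e^{−2uw}` on the line `Re w = σ`: `e^{−2uσ}`. [cite: Dobner2021, §2 p. 6 (proof of Thm. 1)] -/
private theorem norm_cexp_neg_two_mul (u σ T : ℝ) :
    ‖cexp (-(2 * (u : ℂ)) * ((σ : ℂ) + T * I))‖ = Real.exp (-(2 * u * σ)) := by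
  rw [Complex.norm_exp]
  congr 1
  simp [Complex.mul_re, Complex.mul_im]

/-- **The contour form of `Φ_F`, shifted to `Re w = 2`** (`k ≥ 1`): for every real `u`,
`Φ_F(u) = (e^u/π) ∫_ℝ ξ^F(2+iy) e^{−2u(2+iy)} dy` — i.e. the printed
`Φ_F(u) = (e^u/πi) ∫_{½−i∞}^{½+i∞} ξ^F(w) e^{−2uw} dw` (substitution `w = (1+ix)/2`) followed by the
shift of the line of integration to `Re w = 2` ("which can be done because `ξ^F` decays uniformly
exponentially in any vertical strip", p. 6; Cauchy's theorem on the rectangles `[½,2] × [−T,T]`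
applied to the entire `Ξ` of `exists_entire_xi`, horizontal edges `→ 0` by
`exists_norm_xi_le_exp_neg`). [cite: Dobner2021, §2 p. 6 (proof of Thm. 1, the contour form of Φ_F)] -/
theorem Phi_eq_integral_two (hk : 0 < D.numGamma) (u : ℝ) :
    D.Phi u = ((Real.exp u / Real.pi : ℝ) : ℂ) *
      ∫ y : ℝ, D.xi (2 + y * I) * cexp (-(2 * (u : ℂ)) * (2 + y * I)) := by
  obtain ⟨Ξ, hΞd, hΞxi, -⟩ := D.exists_entire_xi
  obtain ⟨M, K, hM, hK, hdec⟩ := D.exists_norm_xi_le_exp_neg hk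
  set G : ℂ → ℂ := fun w ↦ Ξ w * cexp (-(2 * (u : ℂ)) * w) with hG
  -- `G` on the lines of the closed strip (off `w = 1`)
  have hGle : ∀ σ ∈ Icc (1 / 2 : ℝ) 2, ∀ T : ℝ, ((σ : ℂ) + T * I) ≠ 1 →
      ‖G (σ + T * I)‖ ≤ M * Real.exp (4 * |u|) * Real.exp (-(K * |T|)) := by
    intro σ hσ T hne
    have hre : ((σ : ℂ) + T * I).re = σ := by simp
    have him : ((σ : ℂ) + T * I).im = T := by simp
    have h1 := hdec ((σ : ℂ) + T * I) (by rw [hre]; exact hσ.1) (by rw [hre]; exact hσ.2) hne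
    rw [him] at h1
    have h2 : Real.exp (-(2 * u * σ)) ≤ Real.exp (4 * |u|) := by
      refine Real.exp_le_exp.2 ?_
      have : |2 * u * σ| ≤ 4 * |u| := by
        rw [abs_mul, abs_mul, abs_two, abs_of_pos (by linarith [hσ.1] : (0 : ℝ) < σ)]
        nlinarith [abs_nonneg u, hσ.2]
      linarith [neg_abs_le (2 * u * σ)]
    simp only [hG, norm_mul]
    rw [hΞxi _ (by rw [hre]; linarith [hσ.1]) hne, norm_cexp_neg_two_mul]
    calc ‖D.xi (σ + T * I)‖ * Real.exp (-(2 * u * σ))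
        ≤ M * Real.exp (-(K * |T|)) * Real.exp (4 * |u|) :=
          mul_le_mul h1 h2 (Real.exp_pos _).le (by positivity)
      _ = M * Real.exp (4 * |u|) * Real.exp (-(K * |T|)) := by ring
  have hGd : Differentiable ℂ G := hΞd.mul (by fun_prop)
  have hGint : ∀ σ : ℝ, σ ∈ Icc (1 / 2 : ℝ) 2 → σ ≠ 1 →
      Integrable fun T : ℝ ↦ G (σ + T * I) := by
    intro σ hσ hσ1
    have hne : ∀ T : ℝ, ((σ : ℂ) + T * I) ≠ 1 := by
      intro T h
      have := congrArg Complex.re h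
      simp at this
      exact hσ1 this
    refine (((integrable_exp_neg_mul_abs' hK).const_mul
      (M * Real.exp (4 * |u|))).mono' (hGd.continuous.comp (by fun_prop)).aestronglyMeasurable
      (Eventually.of_forall fun T ↦ ?_))
    have := hGle σ hσ T (hne T)
    rwa [neg_mul]
  -- step 1: the defining integral as `e^u · 2 ∫ G(½ + iv) dv` (`x = 2v`)
  have hhalf : (1 / 2 : ℝ) ∈ Icc (1 / 2 : ℝ) 2 := ⟨le_rfl, by norm_num⟩
  have h1 : D.Phi u = ((Real.exp u / Real.pi : ℝ) : ℂ) * ∫ v : ℝ, G (((1 / 2 : ℝ) : ℂ) + v * I) := by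
    rw [Phi]
    have e : (fun x : ℝ ↦ D.xi ((1 + I * x) / 2) * cexp (-(I * x * u))) =
        fun x : ℝ ↦ (Real.exp u : ℂ) *
          (fun v : ℝ ↦ G (((1 / 2 : ℝ) : ℂ) + v * I)) (2⁻¹ * x) := by
      funext x
      have hpt : (1 + I * x) / 2 = ((1 / 2 : ℝ) : ℂ) + ((2⁻¹ * x : ℝ) : ℂ) * I := by
        push_cast; ring
      have hne : ((1 / 2 : ℝ) : ℂ) + ((2⁻¹ * x : ℝ) : ℂ) * I ≠ 1 := by
        intro h
        have := congrArg Complex.re h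
        norm_num at this
      simp only [hG]
      rw [hpt, hΞxi _ (by simp) hne, mul_left_comm, Complex.ofReal_exp, ← Complex.exp_add]
      congr 2
      push_cast
      ring
    rw [e, integral_const_mul,
      Measure.integral_comp_mul_left (fun v : ℝ ↦ G (((1 / 2 : ℝ) : ℂ) + v * I)) 2⁻¹]
    simp only [inv_inv, Nat.abs_ofNat, ← mul_assoc]
    rw [Complex.real_smul, ← mul_assoc]
    congr 1
    push_cast
    field_simp
  -- step 2: shift `Re w = ½ → 2`
  have h2 : ∫ v : ℝ, G (((1 / 2 : ℝ) : ℂ) + v * I) = ∫ v : ℝ, G (((2 : ℝ) : ℂ) + v * I) := by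
    refine MertensBoundRH.integral_vertical_eq_of_tendsto G (by norm_num : (1 / 2 : ℝ) ≤ 2)
      hGd.differentiableOn (hGint (1 / 2) hhalf (by norm_num))
      (hGint 2 ⟨by norm_num, le_rfl⟩ (by norm_num)) fun ε hε ↦ ?_
    set B : ℝ := M * Real.exp (4 * |u|) with hB
    have hB0 : 0 < B := by positivity
    have hlim : Tendsto (fun T : ℝ ↦ B * Real.exp (-(K * T))) atTop (𝓝 0) := by
      have : Tendsto (fun T : ℝ ↦ -(K * T)) atTop atBot :=
        tendsto_neg_atTop_atBot.comp (tendsto_id.const_mul_atTop hK)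
      simpa using (Real.tendsto_exp_atBot.comp this).const_mul B
    obtain ⟨T₀, hT₀⟩ := eventually_atTop.1 (hlim.eventually (gt_mem_nhds hε))
    refine ⟨max T₀ 1, fun σ hσ T hT ↦ ?_⟩
    have hT1 : 1 ≤ |T| := (le_max_right _ _).trans hT
    have hne : ((σ : ℂ) + T * I) ≠ 1 := by
      intro h
      have := congrArg Complex.im h
      simp at this
      rw [this, abs_zero] at hT1
      exact absurd hT1 (by norm_num)
    calc ‖G (σ + T * I)‖ ≤ B * Real.exp (-(K * |T|)) := hGle σ hσ T hne
      _ ≤ B * Real.exp (-(K * max T₀ 1)) := by gcongr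
      _ ≤ ε := (hT₀ (max T₀ 1) (le_max_left _ _)).le
  -- step 3: on `Re w = 2`, `Ξ = ξ^F`
  rw [h1, h2]
  congr 1
  refine integral_congr_ae (Eventually.of_forall fun v ↦ ?_)
  have hne : ((2 : ℂ) + v * I) ≠ 1 := by
    intro h
    have := congrArg Complex.re h
    simp at this
  simp only [hG]
  rw [show (((2 : ℝ) : ℂ)) = (2 : ℂ) by norm_num, hΞxi _ (by simp) hne]


/-! ### (T1-b, step 2) `Φ_F` as a series of inverse Mellin transforms -/

/-- The modulus of `e^{−2uw}` on `Re w = 2`: `e^{−4u}`. [cite: Dobner2021, §2 p. 6 (proof of Thm. 1)] -/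
private theorem norm_cexp_neg_two_mul_two (u y : ℝ) :
    ‖cexp (-(2 * (u : ℂ)) * (2 + y * I))‖ = Real.exp (-(4 * u)) := by
  rw [Complex.norm_exp]
  congr 1
  simp [Complex.mul_re, Complex.mul_im]
  ring

/-- The terms of an `L`-series on `Re w = 2` have the norms of the terms at `w = 2`.
[cite: Dobner2021, §2 p. 5 (condition (i))] -/
private theorem norm_term_two (f : ℕ → ℂ) (y : ℝ) (n : ℕ) :
    ‖LSeries.term f (2 + y * I) n‖ = ‖LSeries.term f 2 n‖ := by
  rw [LSeries.norm_term_eq, LSeries.norm_term_eq]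
  simp

/-- `Q^w e^{−2uw} n^{−w} = (n e^{2u}/Q)^{−w}` for `n ≥ 1` (positive real bases).
[cite: Dobner2021, §2 p. 6 (proof of Thm. 1, eq. (PhiFsum))] -/
private theorem cpow_weight_eq {n : ℕ} (hn : n ≠ 0) (u : ℝ) (w : ℂ) :
    (D.Q : ℂ) ^ w * cexp (-(2 * (u : ℂ)) * w) * ((n : ℂ) ^ w)⁻¹ =
      ((((n : ℝ) * Real.exp (2 * u) / D.Q : ℝ)) : ℂ) ^ (-w) := by
  have hQ := D.Q_pos
  have hn' : (0 : ℝ) < n := by exact_mod_cast Nat.pos_of_ne_zero hn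
  have hv : 0 < (n : ℝ) * Real.exp (2 * u) / D.Q := by positivity
  rw [Complex.cpow_def_of_ne_zero (by exact_mod_cast hQ.ne'),
    show ((n : ℂ)) = ((n : ℝ) : ℂ) by norm_cast,
    Complex.cpow_def_of_ne_zero (by exact_mod_cast hn'.ne'),
    Complex.cpow_def_of_ne_zero (by exact_mod_cast hv.ne'), ← Complex.exp_neg, ← Complex.exp_add,
    ← Complex.exp_add, ← Complex.ofReal_log hQ.le, ← Complex.ofReal_log hn'.le,
    ← Complex.ofReal_log hv.le, Real.log_div (by positivity) hQ.ne',
    Real.log_mul (by positivity) (Real.exp_pos _).ne', Real.log_exp]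
  congr 1
  push_cast
  ring

/-- `mellinInv 2 f 0 = 0` (the base `0` makes the integrand vanish). [cite: Dobner2021, §2 p. 6 (proof of Thm. 1, ψ)] -/
private theorem mellinInv_two_zero (f : ℂ → ℂ) : mellinInv 2 f 0 = 0 := by
  rw [mellinInv]
  have h : ∀ y : ℝ, (((0 : ℝ) : ℂ)) ^ (-(((2 : ℝ) : ℂ) + y * I)) = 0 := by
    intro y
    rw [Complex.ofReal_zero]
    refine Complex.zero_cpow ?_
    intro h0
    have := congrArg Complex.re h0
    simp at this
  simp_rw [h, zero_smul, integral_zero, smul_zero]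

/-- `∫_ℝ v^{−(2+iy)} f(2+iy) dy = 2π · mellinInv 2 f v` (Mathlib's normalisation of the inverse
Mellin transform along `Re w = 2`). [cite: Dobner2021, §2 p. 6 (proof of Thm. 1, ψ)] -/
private theorem integral_eq_two_pi_mul_mellinInv (f : ℂ → ℂ) (v : ℝ) :
    ∫ y : ℝ, (v : ℂ) ^ (-(2 + y * I)) * f (2 + y * I) = 2 * Real.pi * mellinInv 2 f v := by
  rw [mellinInv, Complex.real_smul]
  have e : (fun y : ℝ ↦ (v : ℂ) ^ (-(((2 : ℝ) : ℂ) + y * I)) • f (((2 : ℝ) : ℂ) + y * I)) =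
      fun y : ℝ ↦ (v : ℂ) ^ (-(2 + y * I)) * f (2 + y * I) := by
    funext y; rw [smul_eq_mul]; norm_num
  rw [e, ← mul_assoc]
  have hπ : (Real.pi : ℂ) ≠ 0 := by exact_mod_cast Real.pi_pos.ne'
  rw [show (2 * (Real.pi : ℂ)) * (((1 / (2 * Real.pi) : ℝ) : ℂ)) = 1 by push_cast; field_simp,
    one_mul]

/-- The `n`-th summand of `ξ^F(w) e^{−2uw}` on `Re w = 2` (`n ≥ 1`):
`γ(w) e^{−2uw} aₙ n^{−w} = aₙ α · (n e^{2u}/Q)^{−w} · Ψ(w)`, `Ψ(w) = w^m (w−1)^m ∏ Γ(ωⱼ w + μⱼ)`.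
[cite: Dobner2021, §2 p. 6 (proof of Thm. 1, eq. (PhiFsum))] -/
private theorem summand_eq {n : ℕ} (hn : n ≠ 0) (u : ℝ) (w : ℂ) :
    D.gamma w * cexp (-(2 * (u : ℂ)) * w) * LSeries.term D.coeff w n =
      D.coeff n * D.alpha * (((((n : ℝ) * Real.exp (2 * u) / D.Q : ℝ)) : ℂ) ^ (-w) *
        (w ^ D.polarOrder * (w - 1) ^ D.polarOrder * DobnerLemma2.Psi D.omega D.mu w)) := by
  rw [LSeries.term_of_ne_zero hn, div_eq_mul_inv, ← D.cpow_weight_eq hn u w, gamma,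
    dobnerGamma_apply, DobnerLemma2.Psi]
  ring

/-- **`Φ_F` as a series of inverse Mellin transforms** (eq. (PhiFsum2) of the source, `k ≥ 1`):
for every real `u`,
`Φ_F(u) = 2α e^u ∑ₙ aₙ ψ(n e^{2u}/Q)`, `ψ = mellinInv 2 Ψ`, `Ψ(w) = w^m (w−1)^m ∏ⱼ Γ(ωⱼ w + μⱼ)`
("after expanding out the definition of `ξ^F` in the integrand, we … interchange the infinite sum
coming from the Dirichlet series `F` with the integral … on this new contour the interchange of
sum and integral is valid", p. 6: dominated by `∑|aₙ|n⁻² · e^{−4u} ∫|γ(2+iy)| dy < ∞`).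
[cite: Dobner2021, §2 p. 6 (proof of Thm. 1, eqs. (PhiFsum)–(PhiFsum2))] -/
theorem Phi_eq_tsum_mellinInv (hk : 0 < D.numGamma) (u : ℝ) :
    D.Phi u = 2 * D.alpha * (Real.exp u : ℂ) * ∑' n : ℕ, D.coeff n *
      mellinInv 2 (fun w : ℂ ↦ w ^ D.polarOrder * (w - 1) ^ D.polarOrder * DobnerLemma2.Psi D.omega D.mu w)
        ((n : ℝ) * Real.exp (2 * u) / D.Q) := by
  set Ψ : ℂ → ℂ := fun w : ℂ ↦ w ^ D.polarOrder * (w - 1) ^ D.polarOrder *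
    DobnerLemma2.Psi D.omega D.mu w with hΨ
  set v : ℕ → ℝ := fun n ↦ (n : ℝ) * Real.exp (2 * u) / D.Q with hv
  set f : ℕ → ℝ → ℂ := fun n y ↦ D.gamma (2 + y * I) * cexp (-(2 * (u : ℂ)) * (2 + y * I)) *
    LSeries.term D.coeff (2 + y * I) n with hf
  -- the integrand as a series
  have hser : ∀ y : ℝ, D.xi (2 + y * I) * cexp (-(2 * (u : ℂ)) * (2 + y * I)) = ∑' n : ℕ, f n y := by
    intro y
    have hw : 1 < ((2 : ℂ) + y * I).re := by simp
    rw [xi_apply, D.eqOn_LSeries hw, LSeries, mul_right_comm, ← tsum_mul_left]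
  -- integrability of each summand and summability of the `L¹` norms
  have hγ := D.integrable_gamma_two hk
  have hnorm : ∀ n y, ‖f n y‖ =
      ‖D.gamma (2 + y * I)‖ * (Real.exp (-(4 * u)) * ‖LSeries.term D.coeff 2 n‖) := by
    intro n y
    simp only [hf, norm_mul, norm_cexp_neg_two_mul_two, norm_term_two]
    ring
  have hint : ∀ n : ℕ, Integrable (f n) := by
    intro n
    rcases Nat.eq_zero_or_pos n with rfl | hn
    · have : f 0 = fun _ ↦ 0 := by funext y; simp [hf]
      rw [this]; exact integrable_zero _ _ _
    · have hn0 : (n : ℂ) ≠ 0 := by exact_mod_cast hn.ne'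
      have hcont : Continuous (f n) := by
        simp only [hf]
        refine (D.continuous_gamma_two.mul (by fun_prop)).mul ?_
        simp_rw [LSeries.term_of_ne_zero hn.ne']
        refine continuous_const.div (Continuous.const_cpow (by fun_prop) (Or.inl hn0)) fun y ↦ ?_
        rw [Ne, Complex.cpow_eq_zero_iff, not_and_or]
        exact Or.inl hn0
      refine (hγ.norm.mul_const (Real.exp (-(4 * u)) * ‖LSeries.term D.coeff 2 n‖)).mono'
        hcont.aestronglyMeasurable (Eventually.of_forall fun y ↦ (hnorm n y).le)
  have hsum : Summable fun n : ℕ ↦ ∫ y : ℝ, ‖f n y‖ := by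
    have e : (fun n : ℕ ↦ ∫ y : ℝ, ‖f n y‖) = fun n : ℕ ↦
        ((∫ y : ℝ, ‖D.gamma (2 + y * I)‖) * Real.exp (-(4 * u))) * ‖LSeries.term D.coeff 2 n‖ := by
      funext n
      simp_rw [hnorm n, integral_mul_const]
      ring
    rw [e]
    exact (D.summable 2 (by norm_num)).norm.mul_left _
  -- termwise evaluation
  have hterm : ∀ n : ℕ, ∫ y : ℝ, f n y = D.coeff n * D.alpha * (2 * Real.pi) * mellinInv 2 Ψ (v n) := by
    intro n
    rcases Nat.eq_zero_or_pos n with rfl | hn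
    · have h0 : v 0 = 0 := by simp [hv]
      have : f 0 = fun _ ↦ 0 := by funext y; simp [hf]
      rw [this, h0, mellinInv_two_zero]
      simp
    · have e : f n = fun y : ℝ ↦ D.coeff n * D.alpha *
          (((v n : ℝ) : ℂ) ^ (-(2 + y * I)) * Ψ (2 + y * I)) := by
        funext y
        simp only [hf, hv, hΨ]
        exact D.summand_eq hn.ne' u (2 + y * I)
      rw [e, integral_const_mul, integral_eq_two_pi_mul_mellinInv]
      ring
  -- assemble
  rw [D.Phi_eq_integral_two hk u, integral_congr_ae (Eventually.of_forall hser),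
    ← integral_tsum_of_summable_integral_norm hint hsum]
  simp_rw [hterm]
  have e2 : (fun n : ℕ ↦ D.coeff n * D.alpha * (2 * Real.pi) * mellinInv 2 Ψ (v n)) =
      fun n : ℕ ↦ (D.alpha * (2 * Real.pi)) * (D.coeff n * mellinInv 2 Ψ (v n)) := by
    funext n; ring
  rw [e2, tsum_mul_left, ← mul_assoc]
  congr 1
  have hπ : (Real.pi : ℂ) ≠ 0 := by exact_mod_cast Real.pi_pos.ne'
  push_cast
  field_simp

/-! ### (T1-b, step 3) The reduction `wΓ(aw+b) = a⁻¹Γ(aw+b+1) − (b/a)Γ(aw+b)` and Lemma 2 -/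

section Reduction

variable {k : ℕ} {a : Fin k → ℝ}

/-- Raising `b_{j₀}` by one multiplies `Ψ = ∏Γ(aⱼw + bⱼ)` by `a_{j₀} w + b_{j₀}` (`Γ(z+1) = zΓ(z)`).
[cite: Dobner2021, §2 p. 6 (proof of Thm. 1, the relation wΓ(aw+b))] -/
private theorem Psi_update (b : Fin k → ℂ) (j₀ : Fin k) {w : ℂ}
    (hw : (a j₀ : ℂ) * w + b j₀ ≠ 0) :
    DobnerLemma2.Psi a (Function.update b j₀ (b j₀ + 1)) w =
      ((a j₀ : ℂ) * w + b j₀) * DobnerLemma2.Psi a b w := by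
  unfold DobnerLemma2.Psi
  rw [← Finset.mul_prod_erase Finset.univ _ (Finset.mem_univ j₀),
    ← Finset.mul_prod_erase Finset.univ (fun j ↦ Complex.Gamma ((a j : ℂ) * w + b j))
      (Finset.mem_univ j₀)]
  have hprod : ∏ j ∈ Finset.univ.erase j₀,
      Complex.Gamma ((a j : ℂ) * w + Function.update b j₀ (b j₀ + 1) j) =
      ∏ j ∈ Finset.univ.erase j₀, Complex.Gamma ((a j : ℂ) * w + b j) :=
    Finset.prod_congr rfl fun j hj ↦ by rw [Function.update_of_ne (Finset.ne_of_mem_erase hj)]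
  rw [hprod, Function.update_self, ← add_assoc, Complex.Gamma_add_one _ hw]
  ring

/-- One step of the reduction: `(w + c) P Ψ_b = a_{j₀}⁻¹ P Ψ_{b'} + (c − b_{j₀}/a_{j₀}) P Ψ_b`
with `b' = b + e_{j₀}`. [cite: Dobner2021, §2 p. 6 (proof of Thm. 1, the relation wΓ(aw+b))] -/
private theorem cons_identity (ha : ∀ j, 0 < a j) (b : Fin k → ℂ) (j₀ : Fin k) (c : ℂ) {w : ℂ}
    (hw : (a j₀ : ℂ) * w + b j₀ ≠ 0) (P : ℂ) :
    (w + c) * P * DobnerLemma2.Psi a b w =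
      (1 / (a j₀ : ℂ)) * (P * DobnerLemma2.Psi a (Function.update b j₀ (b j₀ + 1)) w) +
      (c - b j₀ / (a j₀ : ℂ)) * (P * DobnerLemma2.Psi a b w) := by
  rw [Psi_update b j₀ hw]
  have ha0 : (a j₀ : ℂ) ≠ 0 := by exact_mod_cast (ha j₀).ne'
  field_simp
  ring

/-- `e^{−v^{δ₁}} ≤ e^{−v^{δ₂}}` for `v ≥ 1`, `δ₂ ≤ δ₁`. [cite: Dobner2021, Lemma 2, p. 6] -/
private theorem exp_neg_rpow_le {v δ₁ δ₂ : ℝ} (hv : 1 ≤ v) (h : δ₂ ≤ δ₁) :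
    Real.exp (-v ^ δ₁) ≤ Real.exp (-v ^ δ₂) :=
  Real.exp_le_exp.2 (neg_le_neg (Real.rpow_le_rpow_of_exponent_le hv h))

/-- **The reduction to Lemma 2** ("by expanding out the polynomial factors … and then repeatedly
applying the relation `wΓ(aw+b) = a⁻¹Γ(aw+b+1) − (b/a)Γ(aw+b)` one can write `ψ` as a linear
combination of functions to which the lemma does apply", p. 6): for every finite list of shifts
`c_l` and all `bⱼ` with `Re bⱼ ≥ 0`, the function `(∏_l (w + c_l)) ∏ⱼ Γ(aⱼ w + bⱼ)` is integrable
against `r^{−w}` along `Re w = 2` and its inverse Mellin transform along `Re w = 2` is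
`≤ C e^{−v^δ}` for `v ≥ 1` (induction on the list; base case = Lemma 2,
`Literature.NumberTheory.LFunctions.dobner_lemma2_holds`, moved from `Re w = 1` to `Re w = 2` by
`DobnerLemma2.mellinInv_eq`). [cite: Dobner2021, §2 p. 6 (proof of Thm. 1) and Lemma 2] -/
private theorem reduction (hk : 0 < k) (ha : ∀ j, 0 < a j) :
    ∀ (L : List ℂ) (b : Fin k → ℂ), (∀ j, 0 ≤ (b j).re) →
      (∀ r : ℝ, 0 < r → Integrable fun y : ℝ ↦ (r : ℂ) ^ (-(((2 : ℝ) : ℂ) + y * I)) *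
          ((L.map (fun c ↦ (((2 : ℝ) : ℂ) + y * I) + c)).prod *
            DobnerLemma2.Psi a b (((2 : ℝ) : ℂ) + y * I))) ∧
      ∃ δ C : ℝ, 0 < δ ∧ 0 ≤ C ∧ ∀ v : ℝ, 1 ≤ v →
        ‖mellinInv 2 (fun w ↦ (L.map (fun c ↦ w + c)).prod * DobnerLemma2.Psi a b w) v‖ ≤
          C * Real.exp (-v ^ δ) := by
  intro L
  induction L with
  | nil =>
    intro b hb
    have j₀ : Fin k := ⟨0, hk⟩
    refine ⟨fun r hr ↦ ?_, ?_⟩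
    · have h := DobnerLemma2.integrable_integrand_vertical ha hb j₀ hr (σ := 2) two_pos
      refine h.congr (Eventually.of_forall fun y ↦ ?_)
      simp [DobnerLemma2.integrand]
    · obtain ⟨δ, C, hδ, hC⟩ := dobner_lemma2_holds k a b hk ha hb
      refine ⟨δ, max C 0, hδ, le_max_right _ _, fun v hv ↦ ?_⟩
      have e : (fun w : ℂ ↦ (([] : List ℂ).map (fun c ↦ w + c)).prod * DobnerLemma2.Psi a b w) =
          DobnerLemma2.Psi a b := by
        funext w; simp
      rw [e, ← DobnerLemma2.mellinInv_eq ha hb j₀ hv (c := 2) (by norm_num)]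
      exact (hC v hv).trans (by gcongr; exact le_max_left _ _)
  | cons c L ih =>
    intro b hb
    set j₀ : Fin k := ⟨0, hk⟩ with hj₀
    set b' : Fin k → ℂ := Function.update b j₀ (b j₀ + 1) with hb'def
    have hb' : ∀ j, 0 ≤ (b' j).re := by
      intro j
      by_cases hj : j = j₀
      · rw [hj, hb'def, Function.update_self, Complex.add_re, Complex.one_re]
        linarith [hb j₀]
      · rw [hb'def, Function.update_of_ne hj]; exact hb j
    obtain ⟨hI, δ, C, hδ, hC0, hC⟩ := ih b hb
    obtain ⟨hI', δ', C', hδ', hC0', hC'⟩ := ih b' hb'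
    have hw : ∀ y : ℝ, (a j₀ : ℂ) * (((2 : ℝ) : ℂ) + y * I) + b j₀ ≠ 0 := by
      intro y h
      have := congrArg Complex.re h
      simp only [Complex.add_re, Complex.mul_re, Complex.ofReal_re, Complex.ofReal_im,
        Complex.I_re, Complex.I_im, mul_zero, mul_one, zero_mul, sub_zero,
        add_zero, Complex.zero_re] at this
      nlinarith [ha j₀, hb j₀]
    have hpt : ∀ (r : ℝ) (y : ℝ),
        (r : ℂ) ^ (-(((2 : ℝ) : ℂ) + y * I)) *
          (((c :: L).map (fun c' ↦ (((2 : ℝ) : ℂ) + y * I) + c')).prod *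
            DobnerLemma2.Psi a b (((2 : ℝ) : ℂ) + y * I)) =
        (1 / (a j₀ : ℂ)) * ((r : ℂ) ^ (-(((2 : ℝ) : ℂ) + y * I)) *
          ((L.map (fun c' ↦ (((2 : ℝ) : ℂ) + y * I) + c')).prod *
            DobnerLemma2.Psi a b' (((2 : ℝ) : ℂ) + y * I))) +
        (c - b j₀ / (a j₀ : ℂ)) * ((r : ℂ) ^ (-(((2 : ℝ) : ℂ) + y * I)) *
          ((L.map (fun c' ↦ (((2 : ℝ) : ℂ) + y * I) + c')).prod *
            DobnerLemma2.Psi a b (((2 : ℝ) : ℂ) + y * I))) := by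
      intro r y
      rw [List.map_cons, List.prod_cons, cons_identity ha b j₀ c (hw y)]
      ring
    refine ⟨fun r hr ↦ ?_, ?_⟩
    · have h := ((hI' r hr).const_mul (1 / (a j₀ : ℂ))).add
        ((hI r hr).const_mul (c - b j₀ / (a j₀ : ℂ)))
      exact h.congr (Eventually.of_forall fun y ↦ (hpt r y).symm)
    · refine ⟨min δ δ', C' / a j₀ + ‖c - b j₀ / (a j₀ : ℂ)‖ * C, lt_min hδ hδ', ?_, fun v hv ↦ ?_⟩
      · have := ha j₀; positivity
      have hv0 : 0 < v := by linarith
      have hlin : mellinInv 2 (fun w ↦ ((c :: L).map (fun c' ↦ w + c')).prod *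
            DobnerLemma2.Psi a b w) v =
          (1 / (a j₀ : ℂ)) * mellinInv 2 (fun w ↦ (L.map (fun c' ↦ w + c')).prod *
            DobnerLemma2.Psi a b' w) v +
          (c - b j₀ / (a j₀ : ℂ)) * mellinInv 2 (fun w ↦ (L.map (fun c' ↦ w + c')).prod *
            DobnerLemma2.Psi a b w) v := by
        have h1 : ∫ y : ℝ, (v : ℂ) ^ (-(((2 : ℝ) : ℂ) + y * I)) •
            (((c :: L).map (fun c' ↦ (((2 : ℝ) : ℂ) + y * I) + c')).prod *
              DobnerLemma2.Psi a b (((2 : ℝ) : ℂ) + y * I)) =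
            (1 / (a j₀ : ℂ)) * (∫ y : ℝ, (v : ℂ) ^ (-(((2 : ℝ) : ℂ) + y * I)) •
              ((L.map (fun c' ↦ (((2 : ℝ) : ℂ) + y * I) + c')).prod *
                DobnerLemma2.Psi a b' (((2 : ℝ) : ℂ) + y * I))) +
            (c - b j₀ / (a j₀ : ℂ)) * (∫ y : ℝ, (v : ℂ) ^ (-(((2 : ℝ) : ℂ) + y * I)) •
              ((L.map (fun c' ↦ (((2 : ℝ) : ℂ) + y * I) + c')).prod *
                DobnerLemma2.Psi a b (((2 : ℝ) : ℂ) + y * I))) := by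
          simp only [smul_eq_mul]
          simp_rw [hpt v]
          rw [integral_add ((hI' v hv0).const_mul _) ((hI v hv0).const_mul _), integral_const_mul,
            integral_const_mul]
        simp only [mellinInv]
        rw [h1, smul_add, mul_smul_comm, mul_smul_comm]
      rw [hlin]
      have ha0 : 0 < a j₀ := ha j₀
      have hn1 : ‖(1 / (a j₀ : ℂ))‖ = 1 / a j₀ := by
        rw [norm_div, norm_one, Complex.norm_real, Real.norm_of_nonneg ha0.le]
      calc ‖(1 / (a j₀ : ℂ)) * mellinInv 2 (fun w ↦ (L.map (fun c' ↦ w + c')).prod *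
              DobnerLemma2.Psi a b' w) v +
            (c - b j₀ / (a j₀ : ℂ)) * mellinInv 2 (fun w ↦ (L.map (fun c' ↦ w + c')).prod *
              DobnerLemma2.Psi a b w) v‖
          ≤ ‖(1 / (a j₀ : ℂ))‖ * ‖mellinInv 2 (fun w ↦ (L.map (fun c' ↦ w + c')).prod *
              DobnerLemma2.Psi a b' w) v‖ +
            ‖c - b j₀ / (a j₀ : ℂ)‖ * ‖mellinInv 2 (fun w ↦ (L.map (fun c' ↦ w + c')).prod *
              DobnerLemma2.Psi a b w) v‖ := by
            refine (norm_add_le _ _).trans ?_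
            rw [norm_mul, norm_mul]
        _ ≤ (1 / a j₀) * (C' * Real.exp (-v ^ δ')) +
            ‖c - b j₀ / (a j₀ : ℂ)‖ * (C * Real.exp (-v ^ δ)) := by
            rw [hn1]
            gcongr
            · exact hC' v hv
            · exact hC v hv
        _ ≤ (1 / a j₀) * (C' * Real.exp (-v ^ min δ δ')) +
            ‖c - b j₀ / (a j₀ : ℂ)‖ * (C * Real.exp (-v ^ min δ δ')) := by
            have e1 := exp_neg_rpow_le hv (min_le_right δ δ')
            have e2 := exp_neg_rpow_le hv (min_le_left δ δ')
            have hκ := norm_nonneg (c - b j₀ / (a j₀ : ℂ))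
            have ha1 : 0 ≤ 1 / a j₀ := by positivity
            nlinarith [mul_le_mul_of_nonneg_left (mul_le_mul_of_nonneg_left e1 hC0') ha1,
              mul_le_mul_of_nonneg_left (mul_le_mul_of_nonneg_left e2 hC0) hκ]
        _ = (C' / a j₀ + ‖c - b j₀ / (a j₀ : ℂ)‖ * C) * Real.exp (-v ^ min δ δ') := by ring

end Reduction

/-- **Decay of `ψ = mellinInv 2 Ψ`**, `Ψ(w) = w^m (w−1)^m ∏ⱼ Γ(ωⱼ w + μⱼ)` (`k ≥ 1`): there are
`δ > 0`, `C ≥ 0` with `‖ψ(v)‖ ≤ C e^{−v^δ}` for `v ≥ 1` ("we can conclude that there exists a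
`δ > 0` such that `ψ(v) ≪ e^{−v^δ}` for all `v ≥ 1`", p. 6). [cite: Dobner2021, §2 p. 6 (proof of Thm. 1)] -/
theorem exists_norm_mellinInv_Psi_le (hk : 0 < D.numGamma) : ∃ δ C : ℝ, 0 < δ ∧ 0 ≤ C ∧
    ∀ v : ℝ, 1 ≤ v → ‖mellinInv 2 (fun w : ℂ ↦ w ^ D.polarOrder * (w - 1) ^ D.polarOrder *
      DobnerLemma2.Psi D.omega D.mu w) v‖ ≤ C * Real.exp (-v ^ δ) := by
  set L : List ℂ := List.replicate D.polarOrder (0 : ℂ) ++ List.replicate D.polarOrder (-1 : ℂ) with hL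
  obtain ⟨-, δ, C, hδ, hC0, hC⟩ := reduction hk D.omega_pos L D.mu D.mu_re_nonneg
  refine ⟨δ, C, hδ, hC0, fun v hv ↦ ?_⟩
  have e : (fun w : ℂ ↦ w ^ D.polarOrder * (w - 1) ^ D.polarOrder * DobnerLemma2.Psi D.omega D.mu w) =
      fun w : ℂ ↦ (L.map (fun c ↦ w + c)).prod * DobnerLemma2.Psi D.omega D.mu w := by
    funext w
    rw [hL, List.map_append, List.prod_append, List.map_replicate, List.map_replicate,
      List.prod_replicate, List.prod_replicate, add_zero, ← sub_eq_add_neg]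
  rw [e]
  exact hC v hv


/-! ### (T1-b, step 4) Summation: the double-exponential decay of `Φ_F` -/

/-- `∑ n² e^{−n^δ} < ∞` (`δ > 0`): "`aₙ = O(n²) = e^{n^{o(1)}}`" is absorbed by the stretched
exponential (p. 6). [cite: Dobner2021, §2 p. 6 (proof of Thm. 1, last two displays)] -/
private theorem summable_sq_mul_exp_neg_rpow {δ : ℝ} (hδ : 0 < δ) :
    Summable fun n : ℕ ↦ (n : ℝ) ^ 2 * Real.exp (-(n : ℝ) ^ δ) := by
  have hlim := tendsto_rpow_mul_exp_neg_mul_atTop_nhds_zero (4 / δ) 1 one_pos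
  obtain ⟨X₁, hX₁⟩ := eventually_atTop.1 (hlim.eventually (eventually_le_nhds one_pos))
  have hnδ : Tendsto (fun n : ℕ ↦ (n : ℝ) ^ δ) atTop atTop :=
    (tendsto_rpow_atTop hδ).comp tendsto_natCast_atTop_atTop
  refine Summable.of_norm_bounded_eventually_nat
    ((Real.summable_one_div_nat_pow (p := 2)).2 (by norm_num)) ?_
  filter_upwards [hnδ.eventually_ge_atTop X₁, eventually_ge_atTop 1] with n h1 h2
  have hn : (0 : ℝ) < n := by exact_mod_cast h2
  have h3 := hX₁ _ h1
  rw [← Real.rpow_mul hn.le, mul_div_cancel₀ _ hδ.ne', neg_one_mul,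
    show ((n : ℝ) ^ (4 : ℝ)) = ((n : ℝ) ^ 2) ^ 2 by
      rw [show (4 : ℝ) = ((4 : ℕ) : ℝ) by norm_num, Real.rpow_natCast]; ring] at h3
  have hn2 : (0 : ℝ) < (n : ℝ) ^ 2 := by positivity
  rw [Real.norm_of_nonneg (by positivity), le_div_iff₀ hn2]
  calc (n : ℝ) ^ 2 * Real.exp (-(n : ℝ) ^ δ) * (n : ℝ) ^ 2
      = ((n : ℝ) ^ 2) ^ 2 * Real.exp (-(n : ℝ) ^ δ) := by ring
    _ ≤ 1 := h3

/-- For `δ > 0`, `ε > 0` and a natural `p`: `x^p ≤ ε e^{δx}` for all large `x ≥ 0`.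
[cite: Dobner2021, §2 p. 6 (proof of Thm. 1, "for all u large enough")] -/
private theorem exists_pow_le_mul_exp {δ : ℝ} (hδ : 0 < δ) {ε : ℝ} (hε : 0 < ε) (p : ℕ) :
    ∃ X : ℝ, 0 ≤ X ∧ ∀ x : ℝ, X ≤ x → x ^ p ≤ ε * Real.exp (δ * x) := by
  have hlim := tendsto_rpow_mul_exp_neg_mul_atTop_nhds_zero p δ hδ
  obtain ⟨X, hX⟩ := eventually_atTop.1 (hlim.eventually (eventually_le_nhds hε))
  refine ⟨max X 0, le_max_right _ _, fun x hx ↦ ?_⟩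
  have h := hX x ((le_max_left _ _).trans hx)
  rw [Real.rpow_natCast] at h
  calc x ^ p = x ^ p * Real.exp (-δ * x) * Real.exp (δ * x) := by
        rw [mul_assoc, ← Real.exp_add]; simp
    _ ≤ ε * Real.exp (δ * x) := by gcongr

/-- **The bound `Φ_F(u) ≪ e^u e^{−e^{2δu}/(2Q^δ)}`** (`k ≥ 1`), in the form
`‖Φ_F(u)‖ ≤ C exp(u − (e^{2u}/Q)^δ/2)` for `u ≥ (log Q)/2` (so that all arguments `n e^{2u}/Q` of `ψ`
are `≥ 1`): from `Phi_eq_tsum_mellinInv`, `|aₙ| ≤ C n²` and `|ψ(v)| ≤ C e^{−v^δ}`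
("applying this bound in (PhiFsum2) we see that for all sufficiently large `u`,
`Φ_F(u) ≪ e^u ∑ aₙ e^{−(n^δ e^{2δu}/Q^δ)} ≪ e^u e^{−e^{2δu}/(2Q^δ)}`", p. 6). [cite: Dobner2021, §2 p. 6 (proof of Thm. 1)] -/
theorem exists_norm_Phi_le_exp (hk : 0 < D.numGamma) : ∃ δ C : ℝ, 0 < δ ∧ 0 < C ∧
    ∀ u : ℝ, Real.log D.Q / 2 ≤ u →
      ‖D.Phi u‖ ≤ C * Real.exp (u - (Real.exp (2 * u) / D.Q) ^ δ / 2) := by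
  obtain ⟨δ, Cψ, hδ, hCψ0, hψ⟩ := D.exists_norm_mellinInv_Psi_le hk
  obtain ⟨Ca, hCa, ha⟩ := D.exists_norm_coeff_le
  have hQ := D.Q_pos
  set Ψ : ℂ → ℂ := fun w : ℂ ↦ w ^ D.polarOrder * (w - 1) ^ D.polarOrder *
    DobnerLemma2.Psi D.omega D.mu w with hΨ
  set g : ℕ → ℝ := fun n ↦ (n : ℝ) ^ 2 * Real.exp (-((n : ℝ) ^ δ - 1 / 2)) with hg
  have hgsum : Summable g := by
    refine ((summable_sq_mul_exp_neg_rpow hδ).mul_left (Real.exp (1 / 2))).congr fun n ↦ ?_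
    simp only [hg]
    rw [neg_sub, Real.exp_sub, Real.exp_neg]
    ring
  have hg0 : ∀ n, 0 ≤ g n := fun n ↦ by positivity
  set S : ℝ := ∑' n : ℕ, g n with hS
  have hS0 : 0 ≤ S := tsum_nonneg hg0
  refine ⟨δ, 2 * ‖D.alpha‖ * Ca * Cψ * S + 1, hδ, by positivity, fun u hu ↦ ?_⟩
  -- the parameter `X = (e^{2u}/Q)^δ ≥ 1`
  have hbase : 1 ≤ Real.exp (2 * u) / D.Q := by
    rw [le_div_iff₀ hQ, one_mul]
    calc D.Q = Real.exp (Real.log D.Q) := (Real.exp_log hQ).symm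
      _ ≤ Real.exp (2 * u) := Real.exp_le_exp.2 (by linarith)
  set X : ℝ := (Real.exp (2 * u) / D.Q) ^ δ with hX
  have hX1 : 1 ≤ X := Real.one_le_rpow hbase hδ.le
  set v : ℕ → ℝ := fun n ↦ (n : ℝ) * Real.exp (2 * u) / D.Q with hv
  have hv1 : ∀ n : ℕ, 1 ≤ n → 1 ≤ v n := by
    intro n hn
    have : (1 : ℝ) ≤ n := by exact_mod_cast hn
    simp only [hv]
    rw [mul_div_assoc]
    nlinarith
  have hvδ : ∀ n : ℕ, v n ^ δ = (n : ℝ) ^ δ * X := by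
    intro n
    simp only [hv, hX]
    rw [mul_div_assoc, Real.mul_rpow (Nat.cast_nonneg n) (by positivity)]
  -- termwise bound
  have hterm : ∀ n : ℕ, ‖D.coeff n * mellinInv 2 Ψ (v n)‖ ≤
      (Ca * Cψ * Real.exp (-(X / 2))) * g n := by
    intro n
    rcases Nat.eq_zero_or_pos n with rfl | hn
    · have h0 : v 0 = 0 := by simp [hv]
      rw [h0, mellinInv_two_zero]
      simp [hg]
    · rw [norm_mul]
      have h1 := ha n hn.ne'
      have h2 := hψ (v n) (hv1 n hn)
      have hn1 : (1 : ℝ) ≤ (n : ℝ) ^ δ := Real.one_le_rpow (by exact_mod_cast hn) hδ.le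
      have h3 : Real.exp (-v n ^ δ) ≤ Real.exp (-(X / 2)) * Real.exp (-((n : ℝ) ^ δ - 1 / 2)) := by
        rw [← Real.exp_add, hvδ]
        refine Real.exp_le_exp.2 ?_
        nlinarith
      calc ‖D.coeff n‖ * ‖mellinInv 2 Ψ (v n)‖
          ≤ (Ca * (n : ℝ) ^ 2) * (Cψ * Real.exp (-v n ^ δ)) :=
            mul_le_mul h1 h2 (norm_nonneg _) (by positivity)
        _ ≤ (Ca * (n : ℝ) ^ 2) * (Cψ * (Real.exp (-(X / 2)) * Real.exp (-((n : ℝ) ^ δ - 1 / 2)))) := by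
            gcongr
        _ = (Ca * Cψ * Real.exp (-(X / 2))) * g n := by simp only [hg]; ring
  have hsum : Summable fun n : ℕ ↦ ‖D.coeff n * mellinInv 2 Ψ (v n)‖ :=
    Summable.of_nonneg_of_le (fun n ↦ norm_nonneg _) hterm (hgsum.mul_left _)
  -- the estimate
  rw [D.Phi_eq_tsum_mellinInv hk u]
  have hαe : ‖2 * D.alpha * (Real.exp u : ℂ)‖ = 2 * ‖D.alpha‖ * Real.exp u := by
    rw [norm_mul, norm_mul, Complex.norm_two, Complex.norm_real, Real.norm_of_nonneg (Real.exp_pos u).le]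
  calc ‖2 * D.alpha * (Real.exp u : ℂ) * ∑' n : ℕ, D.coeff n * mellinInv 2 Ψ (v n)‖
      = 2 * ‖D.alpha‖ * Real.exp u * ‖∑' n : ℕ, D.coeff n * mellinInv 2 Ψ (v n)‖ := by
        rw [norm_mul, hαe]
    _ ≤ 2 * ‖D.alpha‖ * Real.exp u * ∑' n : ℕ, ‖D.coeff n * mellinInv 2 Ψ (v n)‖ := by
        gcongr; exact norm_tsum_le_tsum_norm hsum
    _ ≤ 2 * ‖D.alpha‖ * Real.exp u * ∑' n : ℕ, (Ca * Cψ * Real.exp (-(X / 2))) * g n := by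
        exact mul_le_mul_of_nonneg_left (Summable.tsum_le_tsum hterm hsum (hgsum.mul_left _))
          (by positivity)
    _ = (2 * ‖D.alpha‖ * Ca * Cψ * S) * Real.exp (u - X / 2) := by
        rw [tsum_mul_left, Real.exp_sub, Real.exp_neg]; simp only [hS]; field_simp
    _ ≤ (2 * ‖D.alpha‖ * Ca * Cψ * S + 1) * Real.exp (u - X / 2) := by
        gcongr; linarith

/-- `‖Φ_F(u)‖ = ‖Φ_F(|u|)‖` (conjugate symmetry). [cite: Dobner2021, §2 p. 6 (proof of Thm. 1: "the decay as u → −∞ then follows immediately by the symmetry of Φ_F")] -/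
theorem norm_Phi_eq_norm_Phi_abs (u : ℝ) : ‖D.Phi u‖ = ‖D.Phi |u|‖ := by
  rcases le_or_gt 0 u with h | h
  · rw [abs_of_nonneg h]
  · rw [abs_of_neg h, show D.Phi u = D.Phi (-(-u)) by rw [neg_neg], D.Phi_neg, Complex.norm_conj]

/-- **Double-exponential decay of `Φ_F`** (`k ≥ 1`): there are `δ, c, C > 0` and `u₀` with
`‖Φ_F(u)‖ ≤ C exp(−c e^{δ|u|})` for `|u| ≥ u₀` ("`Φ_F(u) ≪ e^{−e^{2δu}/(3Q^δ)}` for all `u` large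
enough", p. 6, and the symmetry for `u → −∞`; here `c = 1/(4Q^δ)` and `δ ↦ 2δ`). [cite: Dobner2021, §2 p. 6 (proof of Thm. 1)] -/
theorem exists_norm_Phi_le_exp_neg_exp (hk : 0 < D.numGamma) :
    ∃ δ c C u₀ : ℝ, 0 < δ ∧ 0 < c ∧ 0 < C ∧ ∀ u : ℝ, u₀ ≤ |u| →
      ‖D.Phi u‖ ≤ C * Real.exp (-(c * Real.exp (δ * |u|))) := by
  obtain ⟨δ, C, hδ, hC, hΦ⟩ := D.exists_norm_Phi_le_exp hk
  have hQ := D.Q_pos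
  have hQδ : 0 < D.Q ^ δ := Real.rpow_pos_of_pos hQ δ
  obtain ⟨u₂, -, hu₂⟩ := exists_pow_le_mul_exp (δ := 2 * δ) (by positivity)
    (ε := 1 / (4 * D.Q ^ δ)) (by positivity) 1
  refine ⟨2 * δ, 1 / (4 * D.Q ^ δ), C, max (Real.log D.Q / 2) u₂, by positivity, by positivity,
    hC, fun u hu ↦ ?_⟩
  rw [D.norm_Phi_eq_norm_Phi_abs]
  set x : ℝ := |u| with hx
  have h1 := hΦ x ((le_max_left _ _).trans hu)
  have h2 := hu₂ x ((le_max_right _ _).trans hu)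
  rw [pow_one] at h2
  refine h1.trans ?_
  gcongr C * ?_
  refine Real.exp_le_exp.2 ?_
  have hX : (Real.exp (2 * x) / D.Q) ^ δ = Real.exp (2 * δ * x) / D.Q ^ δ := by
    rw [Real.div_rpow (Real.exp_pos _).le hQ.le, ← Real.exp_mul]
    ring_nf
  rw [hX]
  have e : 1 / (4 * D.Q ^ δ) * Real.exp (2 * δ * x) = Real.exp (2 * δ * x) / D.Q ^ δ / 4 := by
    field_simp
  rw [e] at h2 ⊢
  linarith

/-! ### (T1-b, step 5) Exponential moments, admissibility, `H_t` entire for all real `t` -/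

/-- **Master bound**: for all real `t, c` there is `K > 0` with
`‖Φ_F(u)‖ ≤ K exp(−(|u| + |u|³ + c|u| + t u²))` for every real `u` (the double-exponential decay
beats every such exponent for `|u|` large; `Φ_F` is bounded for `|u|` small). [cite: Dobner2021, §2 p. 6 (proof of Thm. 1: "Φ_F has rapid enough decay")] -/
theorem exists_norm_Phi_le_master (hk : 0 < D.numGamma) (t c : ℝ) : ∃ K : ℝ, 0 < K ∧
    ∀ u : ℝ, ‖D.Phi u‖ ≤ K * Real.exp (-(|u| + |u| ^ 3 + c * |u| + t * u ^ 2)) := by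
  obtain ⟨δ, c₀, C, u₀, hδ, hc₀, hC, hΦ⟩ := D.exists_norm_Phi_le_exp_neg_exp hk
  set A : ℝ := |t| + |c| + 2 with hA
  have hA0 : 0 < A := by positivity
  obtain ⟨U₁, hU₁0, hU₁⟩ := exists_pow_le_mul_exp hδ (ε := c₀ / A) (by positivity) 3
  set U : ℝ := max (max u₀ U₁) 1 with hU
  set B : ℝ := 1 / (2 * Real.pi) * ∫ x : ℝ, ‖D.xi ((1 + I * x) / 2)‖ with hB
  have hB0 : 0 ≤ B := by
    rw [hB]; exact mul_nonneg (by positivity) (integral_nonneg fun x ↦ norm_nonneg _)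
  set M : ℝ := U + U ^ 3 + |c| * U + |t| * U ^ 2 with hM
  refine ⟨max C (B * Real.exp M), lt_max_of_lt_left hC, fun u ↦ ?_⟩
  have hu2 : u ^ 2 = |u| ^ 2 := (sq_abs u).symm
  rcases le_or_gt U |u| with h | h
  · -- large `|u|`
    have hu₀ : u₀ ≤ |u| := le_trans ((le_max_left _ _).trans (le_max_left _ _)) h
    have hU₁' : U₁ ≤ |u| := le_trans ((le_max_right _ _).trans (le_max_left _ _)) h
    have hu1 : 1 ≤ |u| := le_trans (le_max_right _ _) h
    have hexp : A * |u| ^ 3 ≤ c₀ * Real.exp (δ * |u|) := by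
      have := hU₁ |u| hU₁'
      rw [div_mul_eq_mul_div, le_div_iff₀ hA0] at this
      linarith
    have hpoly : |u| + |u| ^ 3 + c * |u| + t * u ^ 2 ≤ A * |u| ^ 3 := by
      rw [hu2, hA]
      have h1 : |u| ≤ |u| ^ 3 := by nlinarith
      have h2 : c * |u| ≤ |c| * |u| ^ 3 := by
        calc c * |u| ≤ |c| * |u| := by gcongr; exact le_abs_self c
          _ ≤ |c| * |u| ^ 3 := by gcongr
      have h3 : t * |u| ^ 2 ≤ |t| * |u| ^ 3 := by
        calc t * |u| ^ 2 ≤ |t| * |u| ^ 2 := by gcongr; exact le_abs_self t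
          _ ≤ |t| * |u| ^ 3 := by gcongr; nlinarith
      nlinarith
    calc ‖D.Phi u‖ ≤ C * Real.exp (-(c₀ * Real.exp (δ * |u|))) := hΦ u hu₀
      _ ≤ C * Real.exp (-(|u| + |u| ^ 3 + c * |u| + t * u ^ 2)) := by
          gcongr; exact hpoly.trans hexp
      _ ≤ max C (B * Real.exp M) * Real.exp (-(|u| + |u| ^ 3 + c * |u| + t * u ^ 2)) := by
          gcongr; exact le_max_left _ _
  · -- small `|u|`
    have hle : |u| + |u| ^ 3 + c * |u| + t * u ^ 2 ≤ M := by
      rw [hu2, hM]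
      have h0 := abs_nonneg u
      have h1 : |u| ^ 3 ≤ U ^ 3 := by gcongr
      have h2 : c * |u| ≤ |c| * U := by
        calc c * |u| ≤ |c| * |u| := by gcongr; exact le_abs_self c
          _ ≤ |c| * U := by gcongr
      have h3 : t * |u| ^ 2 ≤ |t| * U ^ 2 := by
        calc t * |u| ^ 2 ≤ |t| * |u| ^ 2 := by gcongr; exact le_abs_self t
          _ ≤ |t| * U ^ 2 := by gcongr
      linarith
    have hone : 1 ≤ Real.exp M * Real.exp (-(|u| + |u| ^ 3 + c * |u| + t * u ^ 2)) := by
      rw [← Real.exp_add]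
      exact Real.one_le_exp (by linarith)
    calc ‖D.Phi u‖ ≤ B := D.norm_Phi_le u
      _ ≤ B * (Real.exp M * Real.exp (-(|u| + |u| ^ 3 + c * |u| + t * u ^ 2))) :=
          le_mul_of_one_le_right hB0 hone
      _ = B * Real.exp M * Real.exp (-(|u| + |u| ^ 3 + c * |u| + t * u ^ 2)) := by ring
      _ ≤ max C (B * Real.exp M) * Real.exp (-(|u| + |u| ^ 3 + c * |u| + t * u ^ 2)) := by
          gcongr; exact le_max_right _ _

/-- **All exponential moments of `e^{tu²}Φ_F(u)` are finite, for EVERY real `t`** (`k ≥ 1`):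
`∫ ‖e^{tu²}Φ_F(u)‖ e^{c|u|} du < ∞` (supersedes the `t < 0` lemma
`integrable_kernel_exp_moment` of `DobnerSelbergClassNewmanProofs.lean`). [cite: Dobner2021, §2 p. 6 (proof of Thm. 1)] -/
theorem integrable_kernel_exp_moment_all (hk : 0 < D.numGamma) (t c : ℝ) :
    Integrable fun u : ℝ ↦ ‖((Real.exp (t * u ^ 2) : ℝ) : ℂ) * D.Phi u‖ * Real.exp (c * |u|) := by
  obtain ⟨K, hK, hΦ⟩ := D.exists_norm_Phi_le_master hk t c
  have hmeas : AEStronglyMeasurable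
      (fun u : ℝ ↦ ‖((Real.exp (t * u ^ 2) : ℝ) : ℂ) * D.Phi u‖ * Real.exp (c * |u|)) := by
    refine Continuous.aestronglyMeasurable ?_
    exact ((continuous_ofReal.comp (by fun_prop)).mul (D.continuous_Phi hk)).norm.mul (by fun_prop)
  refine (((integrable_exp_neg_mul_abs' one_pos).const_mul K).mono' hmeas
    (Eventually.of_forall fun u ↦ ?_))
  rw [Real.norm_of_nonneg (by positivity), norm_mul, Complex.norm_real,
    Real.norm_of_nonneg (Real.exp_pos _).le]
  have e : Real.exp (t * u ^ 2) * (K * Real.exp (-(|u| + |u| ^ 3 + c * |u| + t * u ^ 2))) *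
      Real.exp (c * |u|) = K * (Real.exp (-(|u| ^ 3)) * Real.exp (-1 * |u|)) := by
    have : Real.exp (t * u ^ 2) * Real.exp (-(|u| + |u| ^ 3 + c * |u| + t * u ^ 2)) *
        Real.exp (c * |u|) = Real.exp (-(|u| ^ 3)) * Real.exp (-1 * |u|) := by
      rw [← Real.exp_add, ← Real.exp_add, ← Real.exp_add]
      congr 1; ring
    calc Real.exp (t * u ^ 2) * (K * Real.exp (-(|u| + |u| ^ 3 + c * |u| + t * u ^ 2))) *
          Real.exp (c * |u|)
        = K * (Real.exp (t * u ^ 2) * Real.exp (-(|u| + |u| ^ 3 + c * |u| + t * u ^ 2)) *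
            Real.exp (c * |u|)) := by ring
      _ = K * (Real.exp (-(|u| ^ 3)) * Real.exp (-1 * |u|)) := by rw [this]
  calc Real.exp (t * u ^ 2) * ‖D.Phi u‖ * Real.exp (c * |u|)
      ≤ Real.exp (t * u ^ 2) * (K * Real.exp (-(|u| + |u| ^ 3 + c * |u| + t * u ^ 2))) *
          Real.exp (c * |u|) := by gcongr; exact hΦ u
    _ = K * (Real.exp (-(|u| ^ 3)) * Real.exp (-1 * |u|)) := e
    _ ≤ K * (1 * Real.exp (-1 * |u|)) := by
        gcongr
        rw [Real.exp_le_one_iff]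
        have := pow_nonneg (abs_nonneg u) 3
        linarith
    _ = K * Real.exp (-1 * |u|) := by ring

/-- `Φ_F` is integrable over `ℝ` (`k ≥ 1`). [cite: Dobner2021, Thm. 3 hypothesis "φ integrable", p. 6] -/
theorem integrable_Phi (hk : 0 < D.numGamma) : Integrable D.Phi := by
  have h := D.integrable_kernel_exp_moment_all hk 0 0
  have h1 : Integrable fun u : ℝ ↦ ‖D.Phi u‖ := by
    refine h.congr (Eventually.of_forall fun u ↦ ?_)
    simp
  exact (integrable_norm_iff (D.continuous_Phi hk).aestronglyMeasurable).1 h1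

/-- **`Φ_F` is an admissible kernel in de Bruijn's sense** (`k ≥ 1`;
`Literature.Analysis.Complex.DeBruijn1950.IsAdmissible`: integrable, `φ(−u) = conj φ(u)`,
`φ = O(e^{−|u|^b})` with `b = 3 > 2`) — the hypotheses of Thm. 3 (de Bruijn) = the tree's
`DeBruijn1950.thm13` for `φ := Φ_F`, as used on p. 7 ("by choosing `φ := Φ_F`"); this is the
`hadm` input of `Literature.NumberTheory.LFunctions.dobner_theorem1_of`. [cite: Dobner2021, §2 pp. 6–7 (proof of Thm. 1) and Thm. 3] -/
theorem isAdmissible_Phi (hk : 0 < D.numGamma) :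
    Literature.Analysis.Complex.DeBruijn1950.IsAdmissible D.Phi := by
  refine ⟨D.integrable_Phi hk, fun u ↦ D.Phi_neg u, ?_⟩
  obtain ⟨K, hK, hΦ⟩ := D.exists_norm_Phi_le_master hk 0 0
  refine ⟨3, K, by norm_num, Eventually.of_forall fun u ↦ ?_⟩
  rw [show (3 : ℝ) = ((3 : ℕ) : ℝ) by norm_num, Real.rpow_natCast]
  calc ‖D.Phi u‖ ≤ K * Real.exp (-(|u| + |u| ^ 3 + 0 * |u| + 0 * u ^ 2)) := hΦ u
    _ ≤ K * Real.exp (-|u| ^ 3) := by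
        gcongr
        linarith [abs_nonneg u]

/-- For every real `t`, `u ↦ e^{tu²} Φ_F(u)` is an admissible kernel (`k ≥ 1`) — the kernel
`φ := e^{t₀u²}Φ_F` of p. 6 ("by applying Theorem 3 with `φ(u) := e^{t₀u²}Φ_F(u)`"); from
`isAdmissible_Phi` by the tilt lemma `ExtendedSelbergDatum.isAdmissible_kernel_of_isAdmissible`
of `DobnerSelbergClassTheorem1Proofs.lean`. [cite: Dobner2021, §2 p. 6 (proof of Thm. 1) and Thm. 3] -/
theorem isAdmissible_kernel (hk : 0 < D.numGamma) (t : ℝ) :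
    Literature.Analysis.Complex.DeBruijn1950.IsAdmissible
      (fun u : ℝ ↦ ((Real.exp (t * u ^ 2) : ℝ) : ℂ) * D.Phi u) :=
  D.isAdmissible_kernel_of_isAdmissible (D.isAdmissible_Phi hk) t

/-- **`H_t` is entire for EVERY real `t`** (`k ≥ 1`; for `t < 0` this is `differentiable_Ht`,
the point here is `t ≥ 0`, in particular `H_0 = H`), from `isAdmissible_Phi` by
`ExtendedSelbergDatum.differentiable_Ht_of_isAdmissible` of `DobnerSelbergClassTheorem1Proofs.lean`.
[cite: Dobner2021, §2 p. 6 (proof of Thm. 1: H_t)] -/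
theorem differentiable_Ht_all (hk : 0 < D.numGamma) (t : ℝ) : Differentiable ℂ (D.Ht t) :=
  D.differentiable_Ht_of_isAdmissible (D.isAdmissible_Phi hk) t

/-- The kernel of `H_{t₀+t}` is the kernel of `H_{t₀}` times de Bruijn's factor `e^{λ²u²/2}` with
`λ = √(2t)` (`t ≥ 0`): the bookkeeping that feeds `DeBruijn1950.thm13` ("by applying Theorem 3
with `φ(u) := e^{t₀u²}Φ_F(u)`, we may conclude `t ∈ 𝒵` for all `t ≥ t₀`", p. 6; Dobner's
`e^{tu²}` is de Bruijn's `e^{λ²u²/2}` with `λ² = 2t`). [cite: Dobner2021, §2 p. 6 (proof of Thm. 1) and Thm. 3] -/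
theorem Ht_add (t₀ : ℝ) {t : ℝ} (ht : 0 ≤ t) (z : ℂ) :
    D.Ht (t₀ + t) z = Literature.Analysis.Complex.trigIntegral
      (fun u : ℝ ↦ (((Real.exp (t₀ * u ^ 2) : ℝ) : ℂ) * D.Phi u) *
        ((Real.exp (Real.sqrt (2 * t) ^ 2 * u ^ 2 / 2) : ℝ) : ℂ)) z := by
  rw [Ht]
  congr 1
  funext u
  rw [Real.sq_sqrt (by positivity), mul_right_comm, ← Complex.ofReal_mul, ← Real.exp_add]
  congr 3
  ring

end ExtendedSelbergDatum

end Literature.NumberTheory.LFunctions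

end
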